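import Mathlib
import Literature.Analysis.FluidPDE.ClassicalNSFourierModes
import Literature.Analysis.FluidPDE.TorusNSBeltramiCurlForm
import Literature.Analysis.FluidPDE.TorusABCFlow
import Literature.Analysis.FunctionSpaces.TorusLerayHelmholtz
import HarnessLib

/-!
# The mean-flow depletion law for Navier–Stokes about a forced single-shell Beltrami host on `T³`

HONEST FRAMING (cell `ns-blowup`, seat `ns-blowup-instab`, human ruling D-0035): nothing here is
a claim about Navier–Stokes blow-up. WHAT THIS IS NOT: not a statement about the marginal tower
N1*; it is the kernel form of ONE exact identity of the cell's census of the MODEL host, the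
refuter's KILLSHEET §XIII.0′ «MEAN-FLOW DEPLETION LAW», graded EXACT on paper:

> For any solution `u = U + v` of the forced NS (`f = νU`) on `𝕋³`, the host coefficient
> `a(t) := ⟨u,U⟩/‖U‖²` obeys `ȧ = −ν(a − 1) − Π[v]/‖U‖²`, `Π[v] := −∫ v·(∇U)·v dx`, because
> `⟨(U·∇)v, U⟩ = −⟨v, ∇|U|²/2⟩ = 0`, `⟨(v·∇)U, U⟩ = ⟨v, ∇|U|²/2⟩ = 0`, `⟨(v·∇)v, U⟩ = Π[v]`,
> `⟨νΔu, U⟩ = −ν⟨u,U⟩`, `⟨f,U⟩ = ν‖U‖²`.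

Here, over the tree's classical forced Navier–Stokes solutions on the unit torus
(`Literature.Analysis.FunctionSpaces.Torus.IsClassicalNSSolutionOn S ν f u p`, Fefferman (1)–(2)
on `T^d`) and its tested momentum equation
(`Torus.IsClassicalNSSolutionOn.hasDerivWithinAt_integral_inner`, Temam 1984 Ch. III §1 (1.13)):

* `hasDerivWithinAt_integral_inner_host` — for a smooth divergence-free host `U` whose
  self-advection is a gradient (`(U·∇)U = ∇(½|U|²)`: every Beltrami field) and which lives on one
  Stokes shell (`ΔU = −κU`), maintained by the force `f = νκU`, every classical solution `u` on a
  convex time set `S` satisfies, within `S`,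
  `d/dt ∫⟪u, U⟫ = ∫⟪u − U, ((u − U)·∇)U⟫ − νκ (∫⟪u, U⟫ − ∫|U|²)`
  — i.e. `ȧ‖U‖² = −Π[v] − νκ(⟨u,U⟩ − ‖U‖²)` with `v = u − U`, `Π[v] = −∫⟪v, (v·∇)U⟫`;
* `hasDerivWithinAt_hostCoefficient` — the normalised form `ȧ = −νκ(a − 1) − Π[v]/‖U‖²`;
* `hasDerivWithinAt_integral_inner_host_of_curl_eq_smul` — the Beltrami–Trkal case
  `curl U = λU` (`κ = λ²`; tree: `Torus.convect_self_eq_gradient_of_curl_eq_smul`,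
  `Torus.laplacian_eq_neg_sq_smul_of_curl_eq_smul`);
* `hasDerivWithinAt_integral_inner_abcFlow` — the forced ABC host on the unit torus
  (`Torus.abcFlow A B C`, `κ = 4π²`, force `4π²ν · u_{ABC}` = the cell's `f = νU` after rescaling
  `(ℝ/2πℤ)³ → T³`);
* `deriv_integral_inner_host_le` — the DEPLETION reading: whenever the perturbation's production
  is non-negative (`Π[v] ≥ 0`, i.e. `∫⟪v,(v·∇)U⟫ ≤ 0`), the host coefficient relaxes at least as
  fast as `−νκ(⟨u,U⟩ − ‖U‖²)`.

The three vanishing integrals are the tree's torus integration-by-parts facts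
`Torus.integral_inner_convect_eq_neg` (antisymmetry of transport by a divergence-free field) and
`Torus.integral_inner_gradient_eq_zero_of_isDivFree`. References: R. Temam, *Navier–Stokes
Equations* (1984), Ch. III §1; A. J. Majda, A. L. Bertozzi, *Vorticity and Incompressible Flow*
(2002), §2.3.2; cell file `KILLSHEET.md` §XIII.0′.
-/

noncomputable section

open MeasureTheory Set
open scoped RealInnerProductSpace

namespace Summit.NavierStokesRegularity.FluidComputer.BeltramiHostDepletion

open Literature.Analysis.FunctionSpaces Literature.Analysis.FluidPDE

variable {S : Set ℝ} {ν kap : ℝ}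
  {U : UnitAddTorus (Fin 3) → EuclideanSpace ℝ (Fin 3)}
  {u : ℝ → UnitAddTorus (Fin 3) → EuclideanSpace ℝ (Fin 3)} {p : ℝ → UnitAddTorus (Fin 3) → ℝ}

/-- `∫⟪w, (U·∇)U⟫ = 0` for a smooth divergence-free `w` when the host's self-advection is a
gradient (Beltrami / Bernoulli: `(U·∇)U = ∇(½|U|²)`). -/
theorem integral_inner_convect_host_self_eq_zero {w : UnitAddTorus (Fin 3) → EuclideanSpace ℝ (Fin 3)}
    (hw : Torus.IsSmooth w) (hwdiv : Torus.IsDivFree w) (hUs : Torus.IsSmooth U)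
    (hconv : ∀ x, Torus.convect U U x = Torus.gradient (fun y => ‖U y‖ ^ 2 / 2) x) :
    ∫ x, ⟪w x, Torus.convect U U x⟫ = 0 := by
  have hq : Torus.IsSmooth (fun y => ‖U y‖ ^ 2 / 2) := by
    have h := hUs.norm_sq
    exact h.div_const 2
  simp_rw [hconv, real_inner_comm (Torus.gradient _ _)]
  exact Torus.integral_inner_gradient_eq_zero_of_isDivFree hw hq hwdiv

/-- `∫⟪U, (w·∇)U⟫ = 0` for smooth `U` and smooth divergence-free `w` (antisymmetry of transport:
`∫⟪(w·∇)U, U⟫ = −∫⟪U, (w·∇)U⟫`). -/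
theorem integral_inner_self_convect_eq_zero {w : UnitAddTorus (Fin 3) → EuclideanSpace ℝ (Fin 3)}
    (hw : Torus.IsSmooth w) (hwdiv : Torus.IsDivFree w) (hUs : Torus.IsSmooth U) :
    ∫ x, ⟪U x, Torus.convect w U x⟫ = 0 := by
  have h := Torus.integral_inner_convect_eq_neg hw hwdiv hUs hUs
  have hc : ∫ x, ⟪Torus.convect w U x, U x⟫ = ∫ x, ⟪U x, Torus.convect w U x⟫ :=
    integral_congr_ae (ae_of_all _ fun x => real_inner_comm _ _)
  rw [hc] at h
  linarith

/-- **Splitting the tested nonlinearity about the host**: for smooth divergence-free `w` and a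
smooth divergence-free host `U` with `(U·∇)U = ∇(½|U|²)`,
`∫⟪w, (w·∇)U⟫ = ∫⟪w − U, ((w − U)·∇)U⟫` — the two cross terms and the host's own term vanish. -/
theorem integral_inner_convect_eq_perturbation {w : UnitAddTorus (Fin 3) → EuclideanSpace ℝ (Fin 3)}
    (hw : Torus.IsSmooth w) (hwdiv : Torus.IsDivFree w) (hUs : Torus.IsSmooth U)
    (hUdiv : Torus.IsDivFree U)
    (hconv : ∀ x, Torus.convect U U x = Torus.gradient (fun y => ‖U y‖ ^ 2 / 2) x) :
    ∫ x, ⟪w x, Torus.convect w U x⟫ = ∫ x, ⟪w x - U x, Torus.convect (w - U) U x⟫ := by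
  have e : ∀ x, ⟪w x - U x, Torus.convect (w - U) U x⟫ =
      (⟪w x, Torus.convect w U x⟫ - ⟪w x, Torus.convect U U x⟫) -
        (⟪U x, Torus.convect w U x⟫ - ⟪U x, Torus.convect U U x⟫) := by
    intro x
    simp only [Torus.convect, Pi.sub_apply, map_sub, inner_sub_left, inner_sub_right]
    abel
  have iA : Integrable (fun x => ⟪w x, Torus.convect w U x⟫) volume :=
    (hw.inner (hw.convect hUs)).integrable
  have iB : Integrable (fun x => ⟪w x, Torus.convect U U x⟫) volume :=
    (hw.inner (hUs.convect hUs)).integrable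
  have iC : Integrable (fun x => ⟪U x, Torus.convect w U x⟫) volume :=
    (hUs.inner (hw.convect hUs)).integrable
  have iD : Integrable (fun x => ⟪U x, Torus.convect U U x⟫) volume :=
    (hUs.inner (hUs.convect hUs)).integrable
  have hB : ∫ x, ⟪w x, Torus.convect U U x⟫ = 0 :=
    integral_inner_convect_host_self_eq_zero hw hwdiv hUs hconv
  have hC : ∫ x, ⟪U x, Torus.convect w U x⟫ = 0 := integral_inner_self_convect_eq_zero hw hwdiv hUs
  have hD : ∫ x, ⟪U x, Torus.convect U U x⟫ = 0 := integral_inner_self_convect_eq_zero hUs hUdiv hUs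
  have iAB : Integrable (fun x => ⟪w x, Torus.convect w U x⟫ - ⟪w x, Torus.convect U U x⟫) volume :=
    iA.sub iB
  have iCD : Integrable (fun x => ⟪U x, Torus.convect w U x⟫ - ⟪U x, Torus.convect U U x⟫) volume :=
    iC.sub iD
  rw [integral_congr_ae (ae_of_all _ e), integral_sub iAB iCD, integral_sub iA iB,
    integral_sub iC iD, hB, hC, hD]
  ring

/-- **KILLSHEET XIII.0′ — the mean-flow depletion law (kernel form).** Let `U` be a smooth
divergence-free host on `T³` with `(U·∇)U = ∇(½|U|²)` and `ΔU = −κU`, and let `u` be a classical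
solution on a convex time set `S` of the Navier–Stokes system with the steady force `f = νκU`
(which makes `U` itself a steady solution). Then within `S`
`d/dt ∫⟪u(t), U⟫ = ∫⟪u − U, ((u − U)·∇)U⟫ − νκ (∫⟪u, U⟫ − ∫|U|²)`,
i.e. `ȧ‖U‖² = −Π[v] − νκ(⟨u,U⟩ − ‖U‖²)` with `v = u − U`, `Π[v] = −∫⟪v,(v·∇)U⟫`. -/
theorem hasDerivWithinAt_integral_inner_host
    (h : Torus.IsClassicalNSSolutionOn S ν (fun _ x => (ν * kap) • U x) u p)
    (hS : Convex ℝ S) (hSU : UniqueDiffOn ℝ S) (hUs : Torus.IsSmooth U) (hUdiv : Torus.IsDivFree U)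
    (hconv : ∀ x, Torus.convect U U x = Torus.gradient (fun y => ‖U y‖ ^ 2 / 2) x)
    (hlap : ∀ x, Torus.laplacian U x = -(kap • U x)) {t : ℝ} (ht : t ∈ S) :
    HasDerivWithinAt (fun s => ∫ x, ⟪u s x, U x⟫)
      ((∫ x, ⟪u t x - U x, Torus.convect (u t - U) U x⟫) -
        ν * kap * ((∫ x, ⟪u t x, U x⟫) - ∫ x, ‖U x‖ ^ 2)) S t := by
  have hd := h.hasDerivWithinAt_integral_inner hS hSU hUs hUdiv ht
  have hut : Torus.IsSmooth (u t) := h.smooth_velocity.isSmooth_slice ht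
  have hdivt : Torus.IsDivFree (u t) := h.divFree t ht
  have h1 : ∫ x, ⟪u t x, Torus.laplacian U x⟫ = -kap * ∫ x, ⟪u t x, U x⟫ := by
    simp_rw [hlap, inner_neg_right, real_inner_smul_right]
    rw [integral_neg, integral_const_mul]
    ring
  have h2 : ∫ x, ⟪(fun (_ : ℝ) (y : UnitAddTorus (Fin 3)) => (ν * kap) • U y) t x, U x⟫ =
      ν * kap * ∫ x, ‖U x‖ ^ 2 := by
    simp_rw [real_inner_smul_left, real_inner_self_eq_norm_sq]
    exact integral_const_mul _ _
  have h3 := integral_inner_convect_eq_perturbation hut hdivt hUs hUdiv hconv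
  refine hd.congr_deriv ?_
  rw [h1, h2, h3]
  ring

/-- **The normalised form** `ȧ = −νκ(a − 1) − Π[v]/‖U‖²` for `a(t) = ⟨u(t),U⟩/‖U‖²`
(`‖U‖² = ∫|U|² ≠ 0`), `v = u − U`, `Π[v] = −∫⟪v,(v·∇)U⟫`. -/
theorem hasDerivWithinAt_hostCoefficient
    (h : Torus.IsClassicalNSSolutionOn S ν (fun _ x => (ν * kap) • U x) u p)
    (hS : Convex ℝ S) (hSU : UniqueDiffOn ℝ S) (hUs : Torus.IsSmooth U) (hUdiv : Torus.IsDivFree U)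
    (hconv : ∀ x, Torus.convect U U x = Torus.gradient (fun y => ‖U y‖ ^ 2 / 2) x)
    (hlap : ∀ x, Torus.laplacian U x = -(kap • U x)) (hE : (∫ x, ‖U x‖ ^ 2) ≠ 0)
    {t : ℝ} (ht : t ∈ S) :
    HasDerivWithinAt (fun s => (∫ x, ⟪u s x, U x⟫) / ∫ x, ‖U x‖ ^ 2)
      (-(ν * kap) * ((∫ x, ⟪u t x, U x⟫) / (∫ x, ‖U x‖ ^ 2) - 1) -
        (-(∫ x, ⟪u t x - U x, Torus.convect (u t - U) U x⟫)) / ∫ x, ‖U x‖ ^ 2) S t := by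
  have hd := (hasDerivWithinAt_integral_inner_host h hS hSU hUs hUdiv hconv hlap ht).div_const
    (∫ x, ‖U x‖ ^ 2)
  refine hd.congr_deriv ?_
  field_simp
  ring

/-- **Depletion reading**: if at time `t` the perturbation `v = u(t) − U` has non-negative
production `Π[v] = −∫⟪v,(v·∇)U⟫ ≥ 0` (every growing and every slowly decaying normal mode,
KILLSHEET XIII.0′(i)), then `d/dt ∫⟪u,U⟫ ≤ −νκ(∫⟪u,U⟫ − ∫|U|²)`: production is paid by the host's
own Beltrami component, which the force can resupply only at the viscous rate `νκ`. -/
theorem deriv_integral_inner_host_le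
    (h : Torus.IsClassicalNSSolutionOn S ν (fun _ x => (ν * kap) • U x) u p)
    (hS : Convex ℝ S) (hSU : UniqueDiffOn ℝ S) (hUs : Torus.IsSmooth U) (hUdiv : Torus.IsDivFree U)
    (hconv : ∀ x, Torus.convect U U x = Torus.gradient (fun y => ‖U y‖ ^ 2 / 2) x)
    (hlap : ∀ x, Torus.laplacian U x = -(kap • U x)) {t : ℝ} (ht : t ∈ S)
    (hprod : (∫ x, ⟪u t x - U x, Torus.convect (u t - U) U x⟫) ≤ 0) :
    derivWithin (fun s => ∫ x, ⟪u s x, U x⟫) S t ≤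
      -(ν * kap * ((∫ x, ⟪u t x, U x⟫) - ∫ x, ‖U x‖ ^ 2)) := by
  rw [(hasDerivWithinAt_integral_inner_host h hS hSU hUs hUdiv hconv hlap ht).derivWithin (hSU t ht)]
  linarith

/-! ### The Beltrami–Trkal host `curl U = λU` and the forced ABC flow -/

/-- **Beltrami–Trkal host** (`curl U = λU`, `div U = 0` on `T³`; then `(U·∇)U = ∇(½|U|²)` and
`ΔU = −λ²U` by the tree's `TorusNSBeltramiCurlForm`): with the force `νλ²U`,
`d/dt ∫⟪u, U⟫ = ∫⟪u − U, ((u − U)·∇)U⟫ − νλ² (∫⟪u, U⟫ − ∫|U|²)` within `S`. -/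
theorem hasDerivWithinAt_integral_inner_host_of_curl_eq_smul {lam : ℝ}
    (h : Torus.IsClassicalNSSolutionOn S ν (fun _ x => (ν * lam ^ 2) • U x) u p)
    (hS : Convex ℝ S) (hSU : UniqueDiffOn ℝ S) (hUs : Torus.IsSmooth U) (hUdiv : Torus.IsDivFree U)
    (hcurl : ∀ x, BDSV.curl U x = lam • U x) {t : ℝ} (ht : t ∈ S) :
    HasDerivWithinAt (fun s => ∫ x, ⟪u s x, U x⟫)
      ((∫ x, ⟪u t x - U x, Torus.convect (u t - U) U x⟫) -
        ν * lam ^ 2 * ((∫ x, ⟪u t x, U x⟫) - ∫ x, ‖U x‖ ^ 2)) S t :=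
  hasDerivWithinAt_integral_inner_host h hS hSU hUs hUdiv
    (Torus.convect_self_eq_gradient_of_curl_eq_smul hUs hcurl)
    (Torus.laplacian_eq_neg_sq_smul_of_curl_eq_smul hUs hUdiv hcurl) ht

/-- **The forced ABC host on the unit torus** (`U = Torus.abcFlow A B C`, `ΔU = −4π²U`,
`(U·∇)U = ∇(½|U|²)`; the cell's `f = νU` on `(ℝ/2πℤ)³` is `f = 4π²ν U` on `T³`): for every classical
solution `u` of Navier–Stokes with that force on a convex time set `S`,
`d/dt ∫⟪u, U⟫ = ∫⟪u − U, ((u − U)·∇)U⟫ − 4π²ν (∫⟪u, U⟫ − ∫|U|²)` within `S`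
— KILLSHEET XIII.0′ for «any ABC amplitudes». -/
theorem hasDerivWithinAt_integral_inner_abcFlow (A B C : ℝ)
    {u : ℝ → UnitAddTorus (Fin 3) → EuclideanSpace ℝ (Fin 3)} {p : ℝ → UnitAddTorus (Fin 3) → ℝ}
    (h : Torus.IsClassicalNSSolutionOn S ν
      (fun _ x => (ν * (4 * Real.pi ^ 2)) • Torus.abcFlow A B C x) u p)
    (hS : Convex ℝ S) (hSU : UniqueDiffOn ℝ S) {t : ℝ} (ht : t ∈ S) :
    HasDerivWithinAt (fun s => ∫ x, ⟪u s x, Torus.abcFlow A B C x⟫)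
      ((∫ x, ⟪u t x - Torus.abcFlow A B C x,
          Torus.convect (u t - Torus.abcFlow A B C) (Torus.abcFlow A B C) x⟫) -
        ν * (4 * Real.pi ^ 2) *
          ((∫ x, ⟪u t x, Torus.abcFlow A B C x⟫) - ∫ x, ‖Torus.abcFlow A B C x‖ ^ 2)) S t :=
  hasDerivWithinAt_integral_inner_host h hS hSU (Torus.isSmooth_abcFlow A B C)
    (Torus.isDivFree_abcFlow A B C) (Torus.convect_abcFlow_self A B C)
    (Torus.laplacian_abcFlow A B C) ht

end Summit.NavierStokesRegularity.FluidComputer.BeltramiHostDepletion
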